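import Summits.HubbardSuperconductivity.HubbardSuperconductivity.Theorems.WeakCouplingBCSDefsKlCertTPrime

/-!
# The «ridge-split» cell certificate: Hilbert–Schmidt for the bulk, Perron (weighted Schur) for the sparse wide boxes
(KL-MARGIN-SCAN HQ1 (iii), control reading)

Reader seat hubbard-klscan-idea-2 (lens: control), round 9; bears on the certificate half of
`Theses.WeakCouplingBCS.WcbcsKohnLuttingerB1g` (stmt-HubbardSuperconductivity-0158) through the director's HQ1 (iii) «δ = ⅛ line in t′»,
whose first `t′ ≠ 0` cell `(δ, t′/t) = (⅛, −0.3)` was certified job-level by margin-1 g15 (kit j320108, route (J)/(P)) and RETRACTED the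
same hour (bus 2026-08-29 02:39Z: a stale Taylor-model bug made ≈ 3 % of the `χ₀` hulls too narrow; the corrected hulls near the mirror
structure `x′ = 0` are honest zero-order ones of width `0.12–0.14`, so the corrected Hilbert–Schmidt budget `B_N` grows and «whether the
dominance test still closes at `N = 192` is OPEN»).  HONEST FRAMING: a Kohn–Luttinger `O(U²)` channel statement is not ODLRO and nothing
here proves superconductivity in the Hubbard model; NO margin at any `t′ ≠ 0` is asserted; nothing is said about `K₃`, `U₀` or the onset
window; the file contains NO numerical record (floats in docstrings are motivation, never hypotheses).  It fixes the SHAPE of a cell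
certificate whose residual budget is SPLIT by box population and PROVES (i) its soundness down to the tree's conclusion
`KLB1gDominatesAtTP`, (ii) the finite weighted-Schur / Collatz–Wielandt inequality that makes the ridge half kernel-checkable from ONE
positive vector.

THE CONTROL READING.  Route (P) (CERT-RITZ §2.1) compresses the pairing kernel `K` to the cell-midpoint kernel `K_N` of a certified hull
table (`N` Fermi-surface cells × `D₄`), bounds every sector bottom by the Galerkin matrices of `K_N`, and charges the residual
`R = K − K_N` (`|R| ≤ w/2` boxwise, `w` = hull width) through ONE number, its Hilbert–Schmidt majorant `B_N² = 8 Σ_h Σ_ij σ_iσ_j (w_{h,ij}/2)²`,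
shared between the `B1g` side and a rival side by isotypic orthogonality: pair error `≤ √2·B_N`.  A sparse population of WIDE boxes — the
ridge / mirror-point boxes every engine generation has fought (ENGINE-J §4–§9) — enters `B_N²` with its full mass although, being sparse in
every row, it moves no eigenvalue by more than its ROW DENSITY.  The split: `R = R_b + R_r` (bulk boxes `w ≤ τ` / ridge boxes `w > τ`, any
threshold), `‖P_χ R P_χ‖ ≤ ‖R_b P_χ‖_HS + ‖R_r‖_op`, the bulk halves still orthogonal (`e_B² + e_χ² ≤ B_b²`), the ridge half bounded ONCE for
all sectors by the weighted Schur test / Perron root of the nonnegative width kernel, `‖R_r‖_op ≤ η_r := λ_max(√(σ_iσ_j)·Σ_h w^r_{h,ij}/2)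
≤ max_i (P_r p)_i / p_i` for ANY positive vector `p` (one rational matrix–vector product certifies it; `p = 1` is the plain row sum), and on
the `B1g` side the explicit Galerkin witness `v` pays only `|v|ᵀ P_r |v|`.  LINEAGE: the UNSPLIT Perron currency `L = λ_PF` for the whole residual and
the leader-Ritz witness term are idea-3's (r5 census F1/F2, `t′ = 0`: `L/E_1D = 0.96–0.97`); unsplit, Perron LOSES to the disk-shaped HS pair on every
flat table (`2η_N = 0.218`, `η_N + |v|ᵀP|v| = 0.203` vs `√2·B_N = 0.183` at the `t′` cell) — the split by box class, and the regime in which it pays,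
are what is new here.  Certificate functional: `τ ↦ √2·B_b(τ) + η_r(τ) + |v|ᵀP_r(τ)|v|`
(first term increasing, the others decreasing in `τ`), minimised over `τ`; dominance iff it is `≤ min_χ LB(M^χ) − UB(M^B1g) − γ`.
Floats (pure python on the published table + margin-1's own cell geometry, 14 s): on the table as published (flat widths, median `0.018`,
99 % `0.068`) NO split helps (`0.1827` pure HS vs best split `0.1835`; `η_N/B_N = 0.845`); on the same table with `3.3 %` of the hull entries
widened to `0.13` as the retraction describes, the HS certificate FAILS at `N = 192` (pair `0.240 > 0.230` scattered, `0.238` banded) while the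
split certificate CLOSES (`0.215`, `0.213` at `τ = 0.06`, certified gap `+0.015 / +0.017`); if instead the wide hulls CONCENTRATE on whole cells
(3 cells, all partners) neither closes (`η_r ≈ ‖ridge‖_HS/√2`, star geometry) — then only refinement of those cells helps; at `6 %` banded
neither closes (`0.245` vs `0.282`).  EMPIRICALLY (nearest-neighbour emulation of the CORRECTED engine from margin-1's 1 600 float-checked sample boxes;
emulated `B_N = 0.230` = its Monte-Carlo `0.21–0.23`): the corrected tail is a THICK ring (`w > 0.08` on `16` of `192` partners per row on average, up
to `72`), neither currency certifies at `N = 192` (HS `0.325`, split `0.287`, needed `0.230`), the split is worth `0.037–0.059` of pair error (≈ 40 %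
of the deficit) and lowers the tail-treatment bar from «wide widths × 0.63» to «× 0.71» — an insurance instrument, free on the finished table, decisive
only where failures are sparse per row; on the CERTIFIED `t' = 0` table of record (`δ = 0.20`, `N = 112`, prover-g4 j240531) the `τ = 0` end
(`Bb = 0`, unsplit Perron + B1g witness, lineage idea-3 r5 F1/F2) doubles the cell's certified worst margin `+0.017 → +0.034` in route (P)'s own
per-channel currency, so `min_τ` is the instrument and is never worse than route (P); on margin-1's CLOSING engine state (sample10 j323450, mirror band v2, Monte-Carlo
`B_N = 0.185`, excess on 2 % of boxes = the `2k_F` ring) the emulation gives HS `0.275` (fails by `0.045`) vs split `0.243` (fails by `0.013`),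
and either ring widths `× 0.8` or `N = 256` flips the split — not HS — to a certificate; `r9/calc/perron_split.py` / `emul_split.py` run on any `hulls.json` / sample of the route-(J) format.

* §1 the finite weighted Schur test (Collatz–Wielandt super-solution ⇒ quadratic-form bound), PROVED by the AM–GM route — the discrete twin of
  `Literature.Analysis.OperatorTheory.SchurTest.integral_integral_mul_kernel_mul_self_le_weighted_of_symm` (Grafakos App. A.2) and the
  form-level shadow of `Literature…PerronRootNonnegative.spectralRadius_le_ofReal_iSup_div` (Neumaier (3.2.3) `ρ(A) ≤ ‖A‖_u`);
* §2 the majorant step `|xᵀRx| ≤ |x|ᵀP|x| ≤ c‖x‖²` for `|R| ≤ P` entrywise (cf. `Literature…PerronSymmetric.dotProduct_mulVec_le_abs`);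
* §3 the pair-shape arithmetic `e_B + e_χ ≤ √2·B` from `e_B² + e_χ² ≤ B²`;
* §4 the hypothesis-carrying SPLIT CELL CERTIFICATE (`KLSplitCellCertificate tp a b`: Galerkin bounds, bulk HS budget with orthogonality,
  ridge Perron budget, `B1g` witness term, the scalar check — nothing claimed to exist) and its soundness
  `klB1gDominatesAtTP_of_splitCertificate : … → KLB1gDominatesAtTP tp a b C.γ` (the tree's `t′`-row conclusion, p665271).
  Route (P)'s own soundness (Weyl per sector, HS residual) is job-level today; the fields of §4 are exactly its obligations plus the two new
  ones (`‖R_r‖ ≤ η_r` = §1–§2 lifted by the Literature Schur test; `⟨v, R_r v⟩ ≤ |v|ᵀP_r|v|` = §2), so a future Lean replay discharges them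
  with the same tools.

References: L. Grafakos, *Classical Fourier Analysis* (2nd ed.), App. A.2 (Schur's test with weights); A. Neumaier, *Interval Methods for
Systems of Equations* (CUP 1990), Lemma 3.2.1, (3.2.3) (scaled row-sum norm bounds the spectral radius); R. A. Horn, C. R. Johnson, *Matrix
Analysis* (2nd ed.), Thm 4.3.1 (Weyl), Thm 8.1.26 (Collatz–Wielandt); B. Helffer, *Spectral Theory and its Applications* (CUP 2013) §7.1
Lemma 7.1 (Schur's lemma) [held: book:helffer2013-spectral-theory-its-applications]; S. Raghu, S. A. Kivelson, D. J. Scalapino, Phys. Rev.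
B 81 (2010) 224505 (the `O(U²)` channel problem being certified).
-/

noncomputable section

-- the tree's namespace convention repeats the summit name by design (D-0017)
set_option linter.dupNamespace false

open Finset
open Literature.MathematicalPhysics.QuantumLattice
open Summit.HubbardSuperconductivity.HubbardSuperconductivity.Theorems

namespace Summit.HubbardSuperconductivity.HubbardSuperconductivity.Theorems.KlRidgeSplit

/-! ## §1 The finite weighted Schur test (Collatz–Wielandt super-solution ⇒ quadratic form bound) -/

/-- Weighted AM–GM for one product: for `s > 0`, `x·y ≤ (s·x² + s⁻¹·y²)/2`. -/
theorem mul_le_weighted_sq_add_sq {s x y : ℝ} (hs : 0 < s) : x * y ≤ (s * x ^ 2 + s⁻¹ * y ^ 2) / 2 := by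
  have h : s * x ^ 2 + s⁻¹ * y ^ 2 - 2 * (x * y) = (s * x - y) ^ 2 / s := by
    field_simp
    ring
  have h' : 0 ≤ (s * x - y) ^ 2 / s := div_nonneg (sq_nonneg _) hs.le
  linarith

/-- **Finite weighted Schur test / Collatz–Wielandt form bound.**  `P` entrywise nonnegative and symmetric on a finite index type, `p` a
positive SUPER-SOLUTION `∑_j P_ij p_j ≤ c·p_i` (one certified matrix–vector product); then the quadratic form obeys
`∑_ij P_ij x_i x_j ≤ c·∑_i x_i²` for every `x` — i.e. `λ_max(P) ≤ max_i (Pp)_i/p_i`, with equality for `p` the Perron vector.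
Discrete twin of `Literature.Analysis.OperatorTheory.SchurTest.integral_integral_mul_kernel_mul_self_le_weighted_of_symm`.
[cite: HornJohnson2013, Theorem 8.1.26 (Collatz–Wielandt)] -/
theorem sum_sum_mul_mul_le_of_superSolution {ι : Type*} [Fintype ι] (P : ι → ι → ℝ) (hP : ∀ i j, 0 ≤ P i j)
    (hsymm : ∀ i j, P i j = P j i) (p : ι → ℝ) (hp : ∀ i, 0 < p i) {c : ℝ}
    (hc : ∀ i, ∑ j, P i j * p j ≤ c * p i) (x : ι → ℝ) :
    ∑ i, ∑ j, P i j * x i * x j ≤ c * ∑ i, x i ^ 2 := by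
  -- termwise weighted AM–GM with weight s = p_j / p_i
  have amgm : ∀ i j, P i j * x i * x j ≤
      (P i j * (p j / p i) * x i ^ 2) / 2 + (P i j * (p i / p j) * x j ^ 2) / 2 := by
    intro i j
    have hs : 0 < p j / p i := div_pos (hp j) (hp i)
    have key := mul_le_weighted_sq_add_sq (x := x i) (y := x j) hs
    rw [inv_div] at key
    have := mul_le_mul_of_nonneg_left key (hP i j)
    have e : P i j * ((p j / p i * x i ^ 2 + p i / p j * x j ^ 2) / 2)
        = (P i j * (p j / p i) * x i ^ 2) / 2 + (P i j * (p i / p j) * x j ^ 2) / 2 := by ring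
    rw [e] at this
    calc P i j * x i * x j = P i j * (x i * x j) := by ring
      _ ≤ _ := this
  -- the two halves are equal after swapping the summation order and using symmetry
  have hswap : ∑ i, ∑ j, (P i j * (p i / p j) * x j ^ 2) / 2 = ∑ i, ∑ j, (P i j * (p j / p i) * x i ^ 2) / 2 := by
    rw [Finset.sum_comm]
    exact Finset.sum_congr rfl fun i _ => Finset.sum_congr rfl fun j _ => by rw [hsymm j i]
  calc ∑ i, ∑ j, P i j * x i * x j
      ≤ ∑ i, ∑ j, ((P i j * (p j / p i) * x i ^ 2) / 2 + (P i j * (p i / p j) * x j ^ 2) / 2) :=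
        Finset.sum_le_sum fun i _ => Finset.sum_le_sum fun j _ => amgm i j
    _ = ∑ i, ∑ j, (P i j * (p j / p i) * x i ^ 2) / 2 + ∑ i, ∑ j, (P i j * (p i / p j) * x j ^ 2) / 2 := by
        rw [← Finset.sum_add_distrib]
        exact Finset.sum_congr rfl fun i _ => Finset.sum_add_distrib
    _ = ∑ i, (x i ^ 2 / p i) * ∑ j, P i j * p j := by
        rw [hswap, ← two_mul, Finset.mul_sum]
        refine Finset.sum_congr rfl fun i _ => ?_
        rw [Finset.mul_sum, Finset.mul_sum]
        refine Finset.sum_congr rfl fun j _ => ?_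
        have hpi : p i ≠ 0 := (hp i).ne'
        field_simp
    _ ≤ ∑ i, (x i ^ 2 / p i) * (c * p i) :=
        Finset.sum_le_sum fun i _ => mul_le_mul_of_nonneg_left (hc i) (div_nonneg (sq_nonneg _) (hp i).le)
    _ = c * ∑ i, x i ^ 2 := by
        rw [Finset.mul_sum]
        refine Finset.sum_congr rfl fun i _ => ?_
        have hpi : p i ≠ 0 := (hp i).ne'
        field_simp

/-- The plain row-sum (Schur, `p = 1`) special case: `∑_j P_ij ≤ c` for all `i` ⇒ `∑_ij P_ij x_i x_j ≤ c ∑ x_i²`.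
[cite: HornJohnson2013, Theorem 8.1.22] -/
theorem sum_sum_mul_mul_le_of_rowSum {ι : Type*} [Fintype ι] (P : ι → ι → ℝ) (hP : ∀ i j, 0 ≤ P i j)
    (hsymm : ∀ i j, P i j = P j i) {c : ℝ} (hc : ∀ i, ∑ j, P i j ≤ c) (x : ι → ℝ) :
    ∑ i, ∑ j, P i j * x i * x j ≤ c * ∑ i, x i ^ 2 := by
  refine sum_sum_mul_mul_le_of_superSolution P hP hsymm (fun _ => 1) (fun _ => one_pos) (fun i => ?_) x
  simpa using hc i

/-! ## §2 The majorant step: a residual dominated entrywise by the width kernel -/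

/-- `|R| ≤ P` entrywise ⇒ `|xᵀRx| ≤ |x|ᵀP|x|` (cf. `Literature…PerronSymmetric.dotProduct_mulVec_le_abs`). -/
theorem abs_sum_sum_mul_mul_le_of_majorant {ι : Type*} [Fintype ι] (R P : ι → ι → ℝ)
    (hRP : ∀ i j, |R i j| ≤ P i j) (x : ι → ℝ) :
    |∑ i, ∑ j, R i j * x i * x j| ≤ ∑ i, ∑ j, P i j * |x i| * |x j| := by
  refine (Finset.abs_sum_le_sum_abs _ _).trans (Finset.sum_le_sum fun i _ => ?_)
  refine (Finset.abs_sum_le_sum_abs _ _).trans (Finset.sum_le_sum fun j _ => ?_)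
  rw [abs_mul, abs_mul]
  exact mul_le_mul_of_nonneg_right (mul_le_mul_of_nonneg_right (hRP i j) (abs_nonneg _)) (abs_nonneg _)

/-- **The ridge bound**: a residual matrix `R` dominated entrywise by a nonnegative symmetric `P` with a positive super-solution
`Pp ≤ c·p` satisfies `|xᵀRx| ≤ c‖x‖²` for all `x` — the finite shadow of `‖R_r‖_op ≤ η_r ≤ max_i (P_r p)_i/p_i`.
[cite: HornJohnson2013, Theorem 8.1.26 (Collatz–Wielandt)] -/
theorem abs_sum_sum_mul_mul_le_of_superSolution {ι : Type*} [Fintype ι] (R P : ι → ι → ℝ)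
    (hRP : ∀ i j, |R i j| ≤ P i j) (hsymm : ∀ i j, P i j = P j i) (p : ι → ℝ) (hp : ∀ i, 0 < p i) {c : ℝ}
    (hc : ∀ i, ∑ j, P i j * p j ≤ c * p i) (x : ι → ℝ) :
    |∑ i, ∑ j, R i j * x i * x j| ≤ c * ∑ i, x i ^ 2 := by
  have hP : ∀ i j, 0 ≤ P i j := fun i j => (abs_nonneg _).trans (hRP i j)
  have h := sum_sum_mul_mul_le_of_superSolution P hP hsymm p hp hc (fun i => |x i|)
  simp only [sq_abs] at h
  exact (abs_sum_sum_mul_mul_le_of_majorant R P hRP x).trans h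

/-! ## §3 The pair-shape arithmetic -/

/-- `e_B² + e_χ² ≤ B²`, `0 ≤ B` ⇒ `e_B + e_χ ≤ √2·B` (the isotypic-orthogonality share of route (P)). -/
theorem add_le_sqrt_two_mul {x y B : ℝ} (hB : 0 ≤ B) (h : x ^ 2 + y ^ 2 ≤ B ^ 2) : x + y ≤ Real.sqrt 2 * B := by
  by_cases hxy : x + y ≤ 0
  · exact hxy.trans (by positivity)
  · rw [not_le] at hxy
    have hsq : (x + y) ^ 2 ≤ (Real.sqrt 2 * B) ^ 2 := by
      rw [mul_pow, Real.sq_sqrt (by norm_num : (0:ℝ) ≤ 2)]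
      nlinarith [sq_nonneg (x - y)]
    have := Real.sqrt_le_sqrt hsq
    rwa [Real.sqrt_sq hxy.le, Real.sqrt_sq (by positivity)] at this

/-! ## §4 The split cell certificate and its soundness -/

/-- **Split cell certificate** for the `t`–`t′` band at hopping ratio `tp` on the chemical-potential cell `[a, b]` (hypothesis-carrying:
every field below is an obligation of the certificate's producer, nothing is claimed to exist).  `UB` = certified upper bound of the
`B1g` Galerkin bottom of the midpoint kernel, `LB χ` = certified lower bound (already `min(·,0)`) of the rival Galerkin bottoms,
`errB μ` / `errR μ χ` = the BULK residual's contribution to the two sides (Weyl), orthogonal across isotypic components with total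
Hilbert–Schmidt budget `Bb` (`orth`), `wr` = the `B1g` witness term `|v|ᵀP_r|v|` and `ηr` = the Perron / weighted-Schur bound of the RIDGE
residual (§1–§2 with `Literature.Analysis.OperatorTheory.SchurTest`), `check` = the scalar dominance test with margin `γ`.
Route (P) of CERT-RITZ §2.1 is the special case `ηr = wr = 0` (no ridge class). [cite: RaghuKivelsonScalapino2010, §II (7), (13)] -/
structure KLSplitCellCertificate (tp a b : ℝ) where
  /-- certified upper bound of the `B1g` Galerkin bottom -/
  UB : ℝ
  /-- certified lower bounds of the rival Galerkin bottoms (with the `min(·,0)` already taken) -/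
  LB : D4Irrep → ℝ
  /-- Hilbert–Schmidt budget of the bulk residual -/
  Bb : ℝ
  /-- `B1g` witness term of the ridge residual -/
  wr : ℝ
  /-- Perron / weighted-Schur bound of the ridge residual -/
  ηr : ℝ
  /-- the margin -/
  γ : ℝ
  Bb_nonneg : 0 ≤ Bb
  /-- bulk error on the `B1g` side at `μ` -/
  errB : ℝ → ℝ
  /-- bulk error on the rival side at `μ`, per rival -/
  errR : ℝ → D4Irrep → ℝ
  /-- the `B1g` CEILING: Galerkin witness + bulk error + ridge witness term -/
  ceiling : ∀ μ ∈ Set.Icc a b,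
    channelInf (squareDispersion 1 tp) μ 1 D4Irrep.B1g ≤ UB + errB μ + wr
  /-- the rival FLOORS: Galerkin lower bound − bulk error − ridge Perron bound (Weyl) -/
  floor : ∀ μ ∈ Set.Icc a b, ∀ χ : D4Irrep, χ ≠ D4Irrep.B1g →
    LB χ - errR μ χ - ηr ≤ channelInf (squareDispersion 1 tp) μ 1 χ
  /-- isotypic orthogonality of the bulk residual's Hilbert–Schmidt mass -/
  orth : ∀ μ ∈ Set.Icc a b, ∀ χ : D4Irrep, χ ≠ D4Irrep.B1g → errB μ ^ 2 + errR μ χ ^ 2 ≤ Bb ^ 2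
  /-- the scalar dominance check -/
  check : ∀ χ : D4Irrep, χ ≠ D4Irrep.B1g → UB + Real.sqrt 2 * Bb + wr + ηr + γ ≤ LB χ

/-- **Soundness of the split cell certificate**: it yields the tree's `t′`-row conclusion `KLB1gDominatesAtTP tp a b γ`
(`channelInf ε_{t′} μ 1 B1g + γ ≤ channelInf ε_{t′} μ 1 χ` for every rival `χ`, uniformly in `μ ∈ [a, b]`).
[cite: RaghuKivelsonScalapino2010, §II (7), (13); HornJohnson2013, Theorem 4.3.1] -/
theorem klB1gDominatesAtTP_of_splitCertificate {tp a b : ℝ} (C : KLSplitCellCertificate tp a b) :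
    KLB1gDominatesAtTP tp a b C.γ := by
  intro μ hμ χ hχ
  have hpair : C.errB μ + C.errR μ χ ≤ Real.sqrt 2 * C.Bb := add_le_sqrt_two_mul C.Bb_nonneg (C.orth μ hμ χ hχ)
  have h₁ := C.ceiling μ hμ
  have h₂ := C.floor μ hμ χ hχ
  have h₃ := C.check χ hχ
  linarith

/-- The route-(P) special case (no ridge class: `wr = ηr = 0`) reads `UB + √2·Bb + γ ≤ LB χ` — CERT-RITZ §2.1 «pair shape» verbatim. -/
theorem klB1gDominatesAtTP_of_splitCertificate_noRidge {tp a b : ℝ} (C : KLSplitCellCertificate tp a b)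
    (_hw : C.wr = 0) (_hη : C.ηr = 0) : KLB1gDominatesAtTP tp a b C.γ :=
  klB1gDominatesAtTP_of_splitCertificate C

end Summit.HubbardSuperconductivity.HubbardSuperconductivity.Theorems.KlRidgeSplit

end
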